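import Literature.Analysis.FluidPDE.NSBoundedMildOseen
import Literature.Analysis.FluidPDE.ClassicalSolutionRescale
import Literature.Analysis.FluidPDE.AxisymmetricEuler
import HarnessLib

/-!
# KNSS 2009, Theorem 6.1, the mildness clause: a bounded solution whose slices decay at
# horizontal infinity is a mild solution

Analysis/FluidPDE facts file on the discharge path of
`Literature.Analysis.FluidPDE.KNSS2009_typeI_rate_vertex` and
`Literature.Analysis.FluidPDE.KNSS2009_typeI_rate_compactness` (`KNSSTypeIRateCore.lean`), the
ingredients of Steps 5–6 of the proof of Theorem 6.2 of Koch–Nadirashvili–Seregin–Šverák, Acta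
Math. 203 (2009) = arXiv:0709.3599. Both ingredients use that the doubly rescaled fields `w⁽ᵏ⁾`
are **mild** solutions, i.e. satisfy the representation formula (3.3) with `f_{jk} = -w_k w_j`
("Since the functions `w⁽ᵏ⁾` are mild solutions of the Navier–Stokes equations in `(A_k, 0)` …",
"Applying the representation formula (3.3) in `ℝ³ × (-1, 0)` with `w⁽ᵏ⁾(x, -1)` as initial datum",
p. 13), and the source obtains this mildness in the proof of Theorem 6.1 (p. 12, last paragraph):

> "It remains to show that, under the assumptions of the theorem, `u` is a mild solution. To do
> this we inspect the decomposition of `u` constructed in Lemma 3.1 with `f_k = -u_k u`. Using the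
> decay of the kernel (3.8) and of the heat kernel, it is easy to check that, under the assumption
> (6.2) [`|u(x, t)| ≤ C/√(x₁² + x₂²)` in `ℝ³ × (0, T)`], all the terms in the decomposition
> `u = v + w + b` will again satisfy (6.2). It follows easily that `b` must vanish and therefore
> `u` is a mild solution."

(and Theorem 6.2, p. 12: "Moreover, `u` is a mild solution of the Navier–Stokes equations (for a
suitable initial datum)" … "We have seen in the proof of Theorem 6.1 that (6.6) implies that `u`
is a mild solution"). This file vendors that clause as the named fact
`KNSS2009_mild_of_rMulNorm_bounded`, in the classical rendering of the KNSS files of the tree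
(`KNSSTypeII`, `KNSSTypeIRate`: classical solutions on an open time interval, bounded on the
sub-slab, in place of bounded weak solutions — a classical solution bounded on a slab is a
bounded weak solution there, `IsClassicalNSSolutionOn.isBoundedWeakNSSolutionOn`), with KNSS's
notion of mild solution written, as everywhere in the tree's KNSS files, as the **Oseen integral
equation** `u(t) = e^{(t-s)Δ}u(s) - B¹_s(u,u)(t)` (`UnboundedOperators.heatExtension`,
`oseenDuhamel`; §3 (3.3) with `f_{jk} = -u_k u_j`, §4 (i) p. 8; the form consumed by
`KNSS2009_typeI_rate_compactness`/`_liouville` and by `KNSS2009_remark61`), and proves its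
transport to a translated vertical axis (`KNSS2009_mild_of_rMulNorm_bounded.translate`), which is
the form in which the proof of Theorem 6.2 uses it (the cylinders `𝒞_k` have axis through
`-M_k e₁`).

## Rendering choices

* **No symmetry hypothesis.** Theorems 6.1 and 6.2 are stated for axisymmetric fields, but the
  printed argument for the mildness clause (quoted above) uses only boundedness, the weak form
  (through Lemma 3.1) and the decay (6.2); accordingly the fact does not assume axisymmetry —
  and cannot, for its user `KNSS2009_typeI_rate_vertex` is stated without the symmetry.
* **The window.** KNSS: `u ∈ L^∞(ℝ³ × (0, T'))` for each `T' < T` and (6.2) on `ℝ³ × (0, T)`,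
  conclusion "`u` is a mild solution in `ℝ³ × (0, T)`". Here: `(u, p)` classical on
  `ℝ³ × (a, b)`, `T ∈ (a, b)`, bounded on `ℝ³ × (a, T]` with `|x'| ‖u‖ ≤ D` there; conclusion: the
  Oseen equation between **all** pairs of times `a < s < t ≤ T`, **pointwise** (both sides are
  continuous: the solution is smooth, and so is the right-hand side for bounded data, Prop. 4.1)
  — KNSS's mild solutions restart at every intermediate time (§4 p. 8, "as an ODE in `t`"; the
  drift-mild identity of `KNSS2009_weak_driftMild` is already stated between all pairs of window
  times), and the closed endpoint `t = T` follows from the open window by continuity in `t` of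
  both sides.
* **Discharge route** (not attempted here): `IsClassicalNSSolutionOn.isBoundedWeakNSSolutionOn`
  (`ClassicalBoundedWeak`) ⟶ Lemma 3.1 in drift-mild form, the accepted fact
  `KNSS2009_weak_driftMild` (`KNSSRegularityDecomposition`: `u = U + b(t)`,
  `U(t) = e^{(t-s)Δ}U(s) - driftDuhamel U b s t`) ⟶ horizontal decay of `e^{(t-s)Δ}u(s)` and of
  the Duhamel term of a horizontally decaying bounded forcing (the kernel decays (3.8) and of the
  heat kernel) forces `b(t) = b(s)` ⟶ identification of the two Oseen renderings of the tree
  (`driftDuhamel`/`oseenHeat` of `OseenHeat.lean` and `oseenDuhamel`/`oseenKernel` of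
  `NSBoundedMildOseen`/`KochTataru`) ⟶ continuity to the endpoint.

## References

* G. Koch, N. Nadirashvili, G. Seregin, V. Šverák, *Liouville theorems for the Navier–Stokes
  equations and applications*, Acta Math. 203 (2009) 83–105 = arXiv:0709.3599 (arXiv pages):
  Theorem 6.1 and the last paragraph of its proof, pp. 11–12; Theorem 6.2 and the first
  paragraph of its proof, p. 12; Lemma 3.1, (3.3), (3.8), pp. 6–7; §4 (i), p. 8.
  [KochNadirashviliSereginSverak2009]
-/

noncomputable section

open MeasureTheory Set Function Filter
open _root_.Topology

namespace Literature.Analysis.FluidPDE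

/-- Local notation for physical space `ℝ³ = EuclideanSpace ℝ (Fin 3)`. -/
local notation "ℝ³" => EuclideanSpace ℝ (Fin 3)

/-! ### The named fact -/

/-- **KNSS 2009, Theorem 6.1, mildness clause** (Acta Math. 203 (2009) = arXiv:0709.3599;
Theorem 6.1, p. 11: "Let `u` be an axi-symmetric vector field in `ℝ³ × (0, T)` which belongs to
`L^∞(ℝ³ × (0, T'))` for each `T' < T`. Assume that `u` is a weak solution of the Navier–Stokes
equations in `ℝ³ × (0, T)` and that `|u(x, t)| ≤ C/√(x₁² + x₂²)` in `ℝ³ × (0, T)` (6.2). Then …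
Moreover, `u` is a mild solution of the Navier–Stokes equations (for a suitable initial datum)";
proof, p. 12, last paragraph: "we inspect the decomposition of `u` constructed in Lemma 3.1 with
`f_k = -u_k u`. Using the decay of the kernel (3.8) and of the heat kernel … all the terms in the
decomposition `u = v + w + b` will again satisfy (6.2). It follows easily that `b` must vanish and
therefore `u` is a mild solution"; restated in Theorem 6.2, p. 12). **Statement** (classical
rendering, module docstring; `ν = 1` as in print). Let `(u, p)` be a classical solution of the
unforced Navier–Stokes system on `ℝ³ × (a, b)`, let `a < T < b`, and assume that `u` is bounded on
`ℝ³ × (a, T]` and satisfies (6.2) there: `|x'| ‖u(t, x)‖ ≤ D` for `t ∈ (a, T]`, `x ∈ ℝ³`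
(`|x'| = cylRadius x = √(x₀² + x₁²)`). Then `u` is a mild solution on `(a, T]`: for all
`a < s < t ≤ T` and every `x`,
`u(t, x) = (e^{(t-s)Δ}u(s))(x) - B¹_s(u, u)(t)(x)` (`UnboundedOperators.heatExtension`,
`oseenDuhamel`: the representation formula (3.3) with datum `u(s)` and `f_{jk} = -u_k u_j`). The
axisymmetry of Theorems 6.1/6.2 is not used by the printed argument for this clause and is not
assumed; the discharge route through `KNSS2009_weak_driftMild` (Lemma 3.1) is recorded in the
module docstring. Users take `(h : KNSS2009_mild_of_rMulNorm_bounded)`. [cite: KochNadirashviliSereginSverak2009, Thm 6.1 (mildness clause) and proof, last paragraph (arXiv pp. 11–12); Thm 6.2 (p. 12)] -/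
def KNSS2009_mild_of_rMulNorm_bounded : Prop :=
  ∀ ⦃a b T : ℝ⦄ ⦃u : ℝ → ℝ³ → ℝ³⦄ ⦃p : ℝ → ℝ³ → ℝ⦄,
    IsClassicalNSSolutionOn (Ioo a b) 1 0 u p → a < T → T < b →
    (∃ L : ℝ, ∀ t ∈ Ioc a T, ∀ x, ‖u t x‖ ≤ L) →
    (∃ D : ℝ, ∀ t ∈ Ioc a T, ∀ x, cylRadius x * ‖u t x‖ ≤ D) →
    ∀ ⦃s t : ℝ⦄, a < s → s < t → t ≤ T → ∀ x,
      u t x = UnboundedOperators.heatExtension (u s) (t - s) x - oseenDuhamel 1 s u u t x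

/-! ### Transport to a translated axis -/

/-- The caloric extension commutes with space translations:
`e^{rΔ}(u(c + ·))(x - c) = e^{rΔ}u (x)` (pointwise, from the convolution formula; no
integrability needed). [folklore] -/
theorem heatExtension_spaceTranslate_sub (f : ℝ³ → ℝ³) (c : ℝ³) (r : ℝ) (x : ℝ³) :
    UnboundedOperators.heatExtension (fun y => f (c + y)) r (x - c) =
      UnboundedOperators.heatExtension f r x := by
  rw [UnboundedOperators.heatExtension_apply, UnboundedOperators.heatExtension_apply]
  refine integral_congr_ae (Eventually.of_forall fun y => ?_)
  simp only [show c + (x - c - y) = x - y by abel]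

/-- The Oseen Duhamel term commutes with space translations:
`B^ν_s(u(c + ·), v(c + ·))(t)(x - c) = B^ν_s(u, v)(t)(x)` (translation invariance of Lebesgue
measure in the inner integral, `integral_add_left_eq_self`). [folklore] -/
theorem oseenDuhamel_spaceTranslate_sub (ν s : ℝ) (u v : ℝ → ℝ³ → ℝ³) (c : ℝ³) (t : ℝ) (x : ℝ³) :
    oseenDuhamel ν s (fun τ y => u τ (c + y)) (fun τ y => v τ (c + y)) t (x - c) =
      oseenDuhamel ν s u v t x := by
  rw [oseenDuhamel_apply, oseenDuhamel_apply]
  refine setIntegral_congr_fun measurableSet_Ioo fun τ _ => ?_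
  have h := integral_add_left_eq_self (μ := (volume : Measure ℝ³))
    (fun y => oseenKernel (ν * (t - τ)) (x - y) (u τ y) (v τ y)) c
  rw [← h]
  refine integral_congr_ae (Eventually.of_forall fun y => ?_)
  simp only [show x - c - y = x - (c + y) by abel]

/-- **The mildness clause about a translated vertical axis** (the form used in the proof of
Theorem 6.2, where the cylinders `𝒞_k` have axis through `-M_k e₁`): under
`KNSS2009_mild_of_rMulNorm_bounded`, a classical solution on `ℝ³ × (a, b)` bounded on
`ℝ³ × (a, T]` with `cylRadius (x - c) ‖u(t, x)‖ ≤ D` there satisfies the Oseen integral equation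
between all `a < s < t ≤ T`, pointwise. Proof: apply the fact to the translate `u(t, c + ·)`
(`IsClassicalNSSolutionOn.spaceTranslate`; the Navier–Stokes system is translation invariant) and
transport both sides back (`heatExtension_spaceTranslate_sub`, `oseenDuhamel_spaceTranslate_sub`). [cite: KochNadirashviliSereginSverak2009, Thm 6.1 (mildness clause), proof last paragraph (arXiv p. 12)] -/
theorem KNSS2009_mild_of_rMulNorm_bounded.translate (h : KNSS2009_mild_of_rMulNorm_bounded)
    {a b T : ℝ} {u : ℝ → ℝ³ → ℝ³} {p : ℝ → ℝ³ → ℝ} (hu : IsClassicalNSSolutionOn (Ioo a b) 1 0 u p)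
    (haT : a < T) (hTb : T < b) (hL : ∃ L : ℝ, ∀ t ∈ Ioc a T, ∀ x, ‖u t x‖ ≤ L) (c : ℝ³)
    (hD : ∃ D : ℝ, ∀ t ∈ Ioc a T, ∀ x, cylRadius (x - c) * ‖u t x‖ ≤ D)
    {s t : ℝ} (has : a < s) (hst : s < t) (htT : t ≤ T) (x : ℝ³) :
    u t x = UnboundedOperators.heatExtension (u s) (t - s) x - oseenDuhamel 1 s u u t x := by
  -- the translated solution
  set v : ℝ → ℝ³ → ℝ³ := fun τ y => u τ (c + y) with hv
  set q : ℝ → ℝ³ → ℝ := fun τ y => p τ (c + y) with hq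
  have hv_sol : IsClassicalNSSolutionOn (Ioo a b) 1 0 v q := by
    have key := hu.spaceTranslate c
    exact key
  have hvL : ∃ L : ℝ, ∀ τ ∈ Ioc a T, ∀ y, ‖v τ y‖ ≤ L := by
    obtain ⟨L, hL⟩ := hL
    exact ⟨L, fun τ hτ y => hL τ hτ (c + y)⟩
  have hvD : ∃ D : ℝ, ∀ τ ∈ Ioc a T, ∀ y, cylRadius y * ‖v τ y‖ ≤ D := by
    obtain ⟨D, hD⟩ := hD
    refine ⟨D, fun τ hτ y => ?_⟩
    have := hD τ hτ (c + y)
    rwa [add_sub_cancel_left] at this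
  have key := h hv_sol haT hTb hvL hvD has hst htT (x - c)
  have e1 : v t (x - c) = u t x := by simp [hv]
  rw [e1, show v s = fun y => u s (c + y) from rfl, heatExtension_spaceTranslate_sub,
    oseenDuhamel_spaceTranslate_sub] at key
  exact key

end Literature.Analysis.FluidPDE

end
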